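import Literature.Algebra.Module.PadicPairingFamilies
import Literature.NumberTheory.IwasawaTheory.PruferPontryaginDual
import Mathlib.NumberTheory.Padics.RingHoms
import HarnessLib

/-!
# Route `ByReductionTypeAtTwo` (rung K4), crux `SupersingularRankZeroAtTwo` (item stmt-BirchSwinnertonDyer-19097), stub 5
# `stub_flatKernelCyclic` ⟸ K86 `H1IwPointsModelFreeAtTwo` (hand hK86-G): **THE KUMMER-STRUCTURE BIDUALITY
# `Hom(N, ℤ_p) ≅ Hom(H, ℚ/ℤ)` for an abstract Kummer map `κ : N ⊗ ℚ_p/ℤ_p ↠≅ H`** (cell `bsd-2adic`, seat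
# `bsd-2adic-tower-1` GEN 65; `--supports 19097`, helper; pure algebra, Mathlib + `PadicPairingFamilies` only)

HONEST FRAMING (D-0036/D-0054): THEOREMS ONLY (no definition, no named fact, no `sorry`, no instance). This is
link (4) («bookkeeping») of the PRINT ∘ KERNEL road to K86 (`Cruxes/SupersingularRankZeroAtTwo/D86H1IwFreeAtTwo.lean`):
`(E(ℚ_∞·ℚ₂) ⊗ ℚ₂/ℤ₂)^∨ = Hom(E(ℚ_∞·ℚ₂), ℤ₂)`, written for an ABSTRACT Kummer structure so that the Galois side
(files `…LocalKummerCocycles`, `…LocalKummerOnto`) only has to produce the map and its five properties.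

SETTING. `N`, `H` abelian groups, `p` a prime, and `κ : N → ℕ → H` («`κ x k` = the Kummer class of `x ⊗ p^{-k}`») with
* `hadd`  : `κ (x + y) k = κ x k + κ y k`;
* `hzero` : `κ x 0 = 0`;
* `hsucc` : `p • κ x (k+1) = κ x k`;
* `hsurj` : every `h : H` is some `κ x k`  (Kummer ONTO — in the application: Coates–Greenberg at a supersingular prime);
* `hker`  : `κ x k = 0 ⇒ p^k ∣ z x` for every functional `z : N →+ ℤ_p`  (Kummer kernel = `p^k N + N[p^∞]`, which every
  `ℤ_p`-valued functional sends into `p^k ℤ_p`).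
These say that `(x, k) ↦ κ x k` factors through a surjection `N ⊗ ℚ_p/ℤ_p ↠ H` whose kernel is killed by the pairing
with `Hom(N, ℤ_p)`; nothing else about `N ⊗ ℚ_p/ℤ_p` is used (no separation property of `N` is needed).

RESULT ★ `exists_toDual_bijective_of_kummerStructure`: there is an additive BIJECTION
`toDual : Hom(N, ℤ_p) → Hom(H, ℚ/ℤ)` with `toDual z (κ x k) = z(x)/p^k mod ℤ` (the local Tate pairing value; `ℚ/ℤ =
AddCircle (1 : ℚ)`). Proof = the tree's `Literature.Algebra.Module.exists_eval_eq_of_character_padicPairingFamily`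
(Pontryagin biduality `(N ⊗ ℚ_p/ℤ_p)^∨ = Hom(N, ℤ_p)` via `PadicInt.lift`) re-run with `H` in place of the group of
pairing characters: well-definedness from `hker`, injectivity from `⋂ p^k ℤ_p = 0`, surjectivity by assembling the
residues `y(κ x k) = a_k(x)/p^k` into `w(x) = lim a_k(x) ∈ ℤ_p`.
19097 OPEN; nothing booked; BSD proved for no curve; typed ≠ proved.

References: [NeukirchSchmidtWingberg2008] I §1 (1.1.8) (Pontryagin duality); [Greenberg1989] §3 p. 109 («`X = Ŝ =
Hom_{ℤ_p}(S, ℚ_p/ℤ_p)`»); tree `Literature/Algebra/Module/PadicPairingFamilies.lean`.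
-/

set_option autoImplicit false
-- the Theorems namespace of this sub repeats the summit name by design (D-0017 nested layout)
set_option linter.dupNamespace false

noncomputable section

open scoped Classical

namespace Summit.BirchSwinnertonDyer.BirchSwinnertonDyer.Theorems

namespace LocalIwH1

open Literature.Algebra.Module Literature.NumberTheory.IwasawaTheory

variable {N : Type*} [AddCommGroup N] {H : Type*} [AddCommGroup H] {p : ℕ} [hp : Fact p.Prime]

/-! ### §1 The calculus of an abstract Kummer map `κ : N → ℕ → H` -/

section Kummer

variable {κ : N → ℕ → H}

/-- `κ 0 k = 0`. [folklore] -/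
theorem kummer_zero_left (hadd : ∀ x y k, κ (x + y) k = κ x k + κ y k) (k : ℕ) : κ 0 k = 0 := by
  have h := hadd 0 0 k
  rw [add_zero] at h
  exact left_eq_add.mp h

/-- `κ (n • x) k = n • κ x k`. [folklore] -/
theorem kummer_nsmul_left (hadd : ∀ x y k, κ (x + y) k = κ x k + κ y k) (n : ℕ) (x : N) (k : ℕ) :
    κ (n • x) k = n • κ x k := by
  induction n with
  | zero => rw [zero_smul, zero_smul, kummer_zero_left hadd]
  | succ n ih => rw [succ_nsmul, hadd, ih, succ_nsmul]

/-- `κ (x − y) k = κ x k − κ y k`. [folklore] -/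
theorem kummer_sub_left (hadd : ∀ x y k, κ (x + y) k = κ x k + κ y k) (x y : N) (k : ℕ) :
    κ (x - y) k = κ x k - κ y k := by
  rw [eq_sub_iff_add_eq, ← hadd, sub_add_cancel]

omit [AddCommGroup N] hp in
/-- `p^j • κ x (k + j) = κ x k` (iterating `p • κ x (k+1) = κ x k`). [folklore] -/
theorem pow_nsmul_kummer_add (hsucc : ∀ x k, p • κ x (k + 1) = κ x k) (x : N) (k j : ℕ) :
    p ^ j • κ x (k + j) = κ x k := by
  induction j with
  | zero => rw [pow_zero, one_smul, add_zero]
  | succ j ih => rw [pow_succ, mul_smul, ← add_assoc, hsucc, ih]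

omit [AddCommGroup N] hp in
/-- `p^k • κ x k = 0` (`x ⊗ p^{-k}` is `p^k`-torsion). [folklore] -/
theorem pow_nsmul_kummer (hzero : ∀ x, κ x 0 = 0) (hsucc : ∀ x k, p • κ x (k + 1) = κ x k) (x : N) (k : ℕ) :
    p ^ k • κ x k = 0 := by
  have h := pow_nsmul_kummer_add hsucc x 0 k
  rw [zero_add, hzero] at h
  exact h

omit hp in
/-- Rescaling: `κ (p^j • x) (k + j) = κ x k` (`p^j x ⊗ p^{-(k+j)} = x ⊗ p^{-k}`). [folklore] -/
theorem kummer_pow_nsmul_left (hadd : ∀ x y k, κ (x + y) k = κ x k + κ y k)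
    (hsucc : ∀ x k, p • κ x (k + 1) = κ x k) (x : N) (k j : ℕ) :
    κ (p ^ j • x) (k + j) = κ x k := by
  rw [kummer_nsmul_left hadd, pow_nsmul_kummer_add hsucc]

omit hp in
/-- The sum of two Kummer classes at a common level: `κ x k + κ x' k' = κ (p^{k'} x + p^k x') (k + k')`. [folklore] -/
theorem kummer_add_eq (hadd : ∀ x y k, κ (x + y) k = κ x k + κ y k)
    (hsucc : ∀ x k, p • κ x (k + 1) = κ x k) (x x' : N) (k k' : ℕ) :
    κ x k + κ x' k' = κ (p ^ k' • x + p ^ k • x') (k + k') := by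
  rw [hadd, kummer_pow_nsmul_left hadd hsucc, add_comm k k', kummer_pow_nsmul_left hadd hsucc]

variable {e : N → ℕ → ((N →+ ℤ_[p]) →+ AddCircle (1 : ℚ))}

/-- **Well-definedness of the pairing on classes.** If the Kummer kernel pairs to zero with `Hom(N, ℤ_p)` (`hker`),
then equal classes `κ x k = κ x' k'` have equal pairing characters `e x k = e x' k'` (`e x k z = z(x)/p^k`).
[cite: NeukirchSchmidtWingberg2008, I §1 (1.1.8)] -/
theorem padicPairingFamily_eq_of_kummer_eq
    (he : ∀ (x : N) (k : ℕ) (z : N →+ ℤ_[p]) (a : ℤ), PadicInt.toZModPow k (z x) = (a : ZMod (p ^ k)) →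
      e x k z = (((a : ℚ) / (p : ℚ) ^ k : ℚ) : AddCircle (1 : ℚ)))
    (hadd : ∀ x y k, κ (x + y) k = κ x k + κ y k) (hsucc : ∀ x k, p • κ x (k + 1) = κ x k)
    (hker : ∀ x k, κ x k = 0 → ∀ z : N →+ ℤ_[p], (p : ℤ_[p]) ^ k ∣ z x)
    {x x' : N} {k k' : ℕ} (h : κ x k = κ x' k') : e x k = e x' k' := by
  have h0 : κ (p ^ k' • x - p ^ k • x') (k + k') = 0 := by
    rw [kummer_sub_left hadd, kummer_pow_nsmul_left hadd hsucc, add_comm k k', kummer_pow_nsmul_left hadd hsucc, h,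
      sub_self]
  have h1 : e (p ^ k' • x) (k + k') = e (p ^ k • x') (k + k') :=
    (padicPairingFamily_eq_iff he _ _ _).mpr (hker _ _ h0)
  rw [← padicPairingFamily_pow_nsmul_left he x k' k, ← padicPairingFamily_pow_nsmul_left he x' k k', add_comm k' k, h1,
    add_comm k k']

end Kummer

/-! ### §2 ★ The biduality `Hom(N, ℤ_p) ≅ Hom(H, ℚ/ℤ)` of a Kummer structure -/

/-- ★ **KUMMER-STRUCTURE BIDUALITY.** Let `κ : N → ℕ → H` be additive in the point, with `κ x 0 = 0`,
`p • κ x (k+1) = κ x k`, ONTO `H`, and with kernel pairing to zero with `Hom(N, ℤ_p)` (`κ x k = 0 ⇒ p^k ∣ z x`). Then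
there is an additive BIJECTION `toDual : Hom(N, ℤ_p) → Hom(H, ℚ/ℤ)` with `toDual z (κ x k) = z(x)/p^k mod ℤ` — the
Pontryagin dual of `H ≅ N ⊗ ℚ_p/ℤ_p / (kernel)` is `Hom(N, ℤ_p)`. Well defined by §1; injective because `⋂ₖ p^k ℤ_p = 0`;
onto because the residues `y(κ x k) = a_k(x)/p^k` of a character `y` are additive in `x` and compatible in `k`
(`p • κ x (k+1) = κ x k`), hence assemble (`PadicInt.lift` on `ℤ[X] → ℤ/p^k`, `X ↦ a_k(x)`) into `w(x) ∈ ℤ_p` with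
`toDual w = y` — the proof of the tree's `exists_eval_eq_of_character_padicPairingFamily`, with `H` for the group of
pairing characters. [cite: NeukirchSchmidtWingberg2008, I §1 (1.1.8) (Pontryagin duality)]
[cite: Greenberg1989, §3 p. 109 (X = Ŝ = Hom(S, ℚ_p/ℤ_p))] -/
theorem exists_toDual_bijective_of_kummerStructure (κ : N → ℕ → H)
    (hadd : ∀ x y k, κ (x + y) k = κ x k + κ y k) (hzero : ∀ x, κ x 0 = 0)
    (hsucc : ∀ x k, p • κ x (k + 1) = κ x k) (hsurj : ∀ h : H, ∃ (x : N) (k : ℕ), κ x k = h)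
    (hker : ∀ x k, κ x k = 0 → ∀ z : N →+ ℤ_[p], (p : ℤ_[p]) ^ k ∣ z x) :
    ∃ toDual : (N →+ ℤ_[p]) →+ (H →+ AddCircle (1 : ℚ)), Function.Bijective toDual ∧
      ∀ (z : N →+ ℤ_[p]) (x : N) (k : ℕ) (a : ℤ), PadicInt.toZModPow k (z x) = (a : ZMod (p ^ k)) →
        toDual z (κ x k) = (((a : ℚ) / (p : ℚ) ^ k : ℚ) : AddCircle (1 : ℚ)) := by
  obtain ⟨e, he⟩ := exists_padicPairingFamily (N := N) (p := p)
  -- a Kummer representative of every class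
  have hrep : ∀ h : H, ∃ xk : N × ℕ, κ xk.1 xk.2 = h := fun h ↦ by
    obtain ⟨x, k, hx⟩ := hsurj h
    exact ⟨(x, k), hx⟩
  choose rep hrep using hrep
  -- the pairing value on a class, through the representative; it is the pairing value of ANY representative
  set T : (N →+ ℤ_[p]) → H → AddCircle (1 : ℚ) := fun z h ↦ e (rep h).1 (rep h).2 z with hTdef
  have hT : ∀ (z : N →+ ℤ_[p]) (x : N) (k : ℕ), T z (κ x k) = e x k z := by
    intro z x k
    have h := padicPairingFamily_eq_of_kummer_eq he hadd hsucc hker (hrep (κ x k))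
    change e (rep (κ x k)).1 (rep (κ x k)).2 z = e x k z
    rw [h]
  -- additivity in the class
  have hTadd : ∀ (z : N →+ ℤ_[p]) (h h' : H), T z (h + h') = T z h + T z h' := by
    intro z h h'
    obtain ⟨x, k, rfl⟩ := hsurj h
    obtain ⟨x', k', rfl⟩ := hsurj h'
    rw [kummer_add_eq hadd hsucc, hT, hT, hT, padicPairingFamily_add_left he, AddMonoidHom.add_apply,
      padicPairingFamily_pow_nsmul_left he, add_comm k k', padicPairingFamily_pow_nsmul_left he]
  -- the map
  let toDual : (N →+ ℤ_[p]) →+ (H →+ AddCircle (1 : ℚ)) :=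
    { toFun := fun z ↦
        { toFun := T z
          map_zero' := by
            have h := hTadd z 0 0
            rw [add_zero] at h
            exact left_eq_add.mp h
          map_add' := hTadd z }
      map_zero' := by
        ext h
        change e (rep h).1 (rep h).2 0 = 0
        rw [map_zero]
      map_add' := fun z z' ↦ by
        ext h
        change e (rep h).1 (rep h).2 (z + z') = e (rep h).1 (rep h).2 z + e (rep h).1 (rep h).2 z'
        rw [map_add] }
  have htoDual : ∀ z h, toDual z h = T z h := fun _ _ ↦ rfl
  refine ⟨toDual, ⟨?_, ?_⟩, fun z x k a ha ↦ by rw [htoDual, hT, he x k z a ha]⟩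
  · -- injective: `toDual z = 0` forces `p^k ∣ z x` for all `k`, so `z x = 0`
    refine (injective_iff_map_eq_zero toDual).mpr fun z hz ↦ ?_
    ext x
    rw [AddMonoidHom.zero_apply]
    -- `⋂ₖ p^k ℤ_p = 0`
    refine PadicInt.ext_of_toZModPow.mp fun k ↦ ?_
    rw [map_zero, ← RingHom.mem_ker, PadicInt.ker_toZModPow, Ideal.mem_span_singleton]
    have h : T z (κ x k) = 0 := by rw [← htoDual, hz, AddMonoidHom.zero_apply]
    rw [hT] at h
    exact (padicPairingFamily_apply_eq_zero_iff he x k z).mp h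
  · -- surjective: assemble the residues of a character `y` into a functional `w`
    intro y
    -- residues `r k x ∈ ℤ/p^k` with `y (κ x k) = r/p^k`
    have hres : ∀ (k : ℕ) (x : N), ∃ r : ZMod (p ^ k), ∀ a : ℤ,
        y (κ x k) = (((a : ℚ) / (p : ℚ) ^ k : ℚ) : AddCircle (1 : ℚ)) ↔ r = (a : ZMod (p ^ k)) := by
      intro k x
      have htors : p ^ k • y (κ x k) = 0 := by rw [← map_nsmul, pow_nsmul_kummer hzero hsucc, map_zero]
      obtain ⟨a₀, ha₀⟩ := QpModZp.addCircle_exists_eq_coe_int_div_of_nsmul_eq_zero htors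
      refine ⟨(a₀ : ZMod (p ^ k)), fun a ↦ ?_⟩
      rw [ha₀, QpModZp.addCircle_coe_int_div_eq_coe_int_div_iff]
    choose r hr using hres
    have hry : ∀ (k : ℕ) (x : N) (a : ℤ), r k x = a →
        y (κ x k) = (((a : ℚ) / (p : ℚ) ^ k : ℚ) : AddCircle (1 : ℚ)) :=
      fun k x a h ↦ (hr k x a).mpr h
    -- additivity of the residues in `x`
    have hradd : ∀ (k : ℕ) (x x' : N), r k (x + x') = r k x + r k x' := by
      intro k x x'
      obtain ⟨a, ha⟩ := ZMod.intCast_surjective (r k x)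
      obtain ⟨b, hb⟩ := ZMod.intCast_surjective (r k x')
      have h : y (κ (x + x') k) = ((((a + b : ℤ) : ℚ) / (p : ℚ) ^ k : ℚ) : AddCircle (1 : ℚ)) := by
        rw [hadd, map_add, hry k x a ha.symm, hry k x' b hb.symm, ← AddCircle.coe_add, ← add_div, Int.cast_add]
      rw [(hr k (x + x') (a + b)).mp h, Int.cast_add, ha, hb]
    -- compatibility of successive residues
    have hcompat1 : ∀ (k : ℕ) (x : N),
        ZMod.castHom (pow_dvd_pow p (Nat.le_succ k)) (ZMod (p ^ k)) (r (k + 1) x) = r k x := by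
      intro k x
      obtain ⟨a, ha⟩ := ZMod.intCast_surjective (r (k + 1) x)
      have h1 := hry (k + 1) x a ha.symm
      have h2 : y (κ x k) = (((a : ℚ) / (p : ℚ) ^ k : ℚ) : AddCircle (1 : ℚ)) := by
        have hp0 : (p : ℚ) ≠ 0 := Nat.cast_ne_zero.mpr hp.out.ne_zero
        rw [← hsucc, map_nsmul, h1, ← AddCircle.coe_nsmul]
        congr 1
        rw [nsmul_eq_mul, pow_succ, ← mul_div_assoc, mul_comm (p : ℚ), mul_div_mul_right _ _ hp0]
      rw [← ha, map_intCast, ((hr k x a).mp h2)]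
    have hstep : ∀ (k : ℕ) (x : N) (a : ℤ), r (k + 1) x = a → r k x = a := by
      intro k x a h
      rw [← hcompat1 k x, h, map_intCast]
    have hcompatInt : ∀ (d k1 : ℕ) (x : N) (a : ℤ), r (k1 + d) x = a → r k1 x = a := by
      intro d
      induction d with
      | zero => intro k1 x a h; exact h
      | succ d ih => intro k1 x a h; exact ih k1 x a (hstep (k1 + d) x a h)
    have hcompat : ∀ (k1 k2 : ℕ) (hk : k1 ≤ k2) (x : N),
        ZMod.castHom (pow_dvd_pow p hk) (ZMod (p ^ k1)) (r k2 x) = r k1 x := by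
      intro k1 k2 hk x
      obtain ⟨d, rfl⟩ := Nat.exists_eq_add_of_le hk
      obtain ⟨a, ha⟩ := ZMod.intCast_surjective (r (k1 + d) x)
      rw [← ha, map_intCast]
      exact (hcompatInt d k1 x a ha.symm).symm
    -- ring homomorphisms `ℤ[X] → ℤ/p^k`, `X ↦ r k x`, and their compatibility
    let f : N → ∀ k : ℕ, Polynomial ℤ →+* ZMod (p ^ k) := fun x k ↦
      Polynomial.eval₂RingHom (Int.castRingHom (ZMod (p ^ k))) (r k x)
    have hfX : ∀ x k, f x k Polynomial.X = r k x := fun x k ↦ Polynomial.eval₂_X _ _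
    have hfcompat : ∀ (x : N) (k1 k2 : ℕ) (hk : k1 ≤ k2),
        (ZMod.castHom (pow_dvd_pow p hk) (ZMod (p ^ k1))).comp (f x k2) = f x k1 := by
      intro x k1 k2 hk
      refine Polynomial.ringHom_ext (fun a ↦ by simp [f]) ?_
      rw [RingHom.comp_apply, hfX, hfX, hcompat k1 k2 hk x]
    -- the `p`-adic integers `w x` and their residues
    let w : N → ℤ_[p] := fun x ↦ PadicInt.lift (hfcompat x) Polynomial.X
    have hw : ∀ x k, PadicInt.toZModPow k (w x) = r k x := by
      intro x k
      have h := PadicInt.lift_spec (hfcompat x) k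
      have h' := DFunLike.congr_fun h Polynomial.X
      rw [RingHom.comp_apply] at h'
      rw [show w x = PadicInt.lift (hfcompat x) Polynomial.X from rfl, h', hfX]
    -- additivity
    have hwadd : ∀ x x', w (x + x') = w x + w x' := by
      intro x x'
      refine PadicInt.ext_of_toZModPow.mp fun k ↦ ?_
      rw [map_add, hw, hw, hw, hradd]
    have hw0 : w 0 = 0 := by
      have h := hwadd 0 0
      rw [add_zero] at h
      have : w 0 + w 0 = w 0 + 0 := by rw [add_zero]; exact h.symm
      exact add_left_cancel this
    let wh : N →+ ℤ_[p] := { toFun := w, map_zero' := hw0, map_add' := hwadd }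
    refine ⟨wh, ?_⟩
    ext h
    obtain ⟨x, k, rfl⟩ := hsurj h
    obtain ⟨a, ha⟩ := ZMod.intCast_surjective (r k x)
    rw [hry k x a ha.symm, htoDual, hT, he x k wh a (by rw [show wh x = w x from rfl, hw, ha])]

end LocalIwH1

end Summit.BirchSwinnertonDyer.BirchSwinnertonDyer.Theorems

end
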